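import Literature.Computability.QuantumComplexity.TruncatedStateFidelity
import Mathlib.LinearAlgebra.Matrix.Kronecker
import HarnessLib

/-!
# Fidelity-rescaled observables of a truncated state: the exact one-step decomposition behind the
  MPS ‘rescaling’ heuristic, and the published estimators it is compared with

Topic `Literature/Computability/QuantumComplexity` (pub-qadeq lane, CLAIMS E-21 / S-6: the
Quantinuum H2 7×8 digital-Ising experiment [cite: HaghshenasEtAl2026] and its refereed classical
challenger [cite: MandraEtAl2026], whose method is an MPS simulation at bond dimension χ ≤ 4096 whose
observables are RESCALED by a power of the running truncation fidelity). Companion of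
`TruncatedStateFidelity.lean` (same vocabulary: `braket`, `superpose`, `keptWeight`,
`discardedWeight`, `truncUnit`).

HONEST FRAMING: instance-level adjudication of specific advantage claims; no claim about BQP vs BPP
or the summit. Nothing in this file says that the rescaling heuristic is accurate for any circuit;
it proves the exact ONE-STEP identity the heuristic's authors give as its justification, proves the
vanishing of the cross term they assert for one-sided observables, and fixes the published
multi-step ESTIMATORS as real-valued definitions so that a lane report can name them. Whether those
estimators track the exact values over many steps is an empirical question (E21-SPEC §8(d)).

## Setting and sources

As in `TruncatedStateFidelity.lean`: an orthonormal family `w : κ → (ι → ℂ)` (the Schmidt vectors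
across the bond being truncated), coefficients `c`, the state `ψ = Σₖ cₖ wₖ`, its kept part
`φ_K = Σ_{k∈K} cₖ wₖ`, discarded part `χ_K = Σ_{k∉K} cₖ wₖ = ψ − φ_K`, kept weight `p_K`, and the
renormalised truncation `φ̂_K = φ_K/√p_K`. An observable is a matrix `O : Matrix ι ι ℂ` acting by
`Matrix.mulVec`; `obsForm O u v = ⟨u|O|v⟩`.

[cite: MandraEtAl2026, §III eq. (7)] writes one truncation step as
`U|ψ_MPS(i−1)⟩ = √f(i) |ψ_MPS(i)⟩ + √(1 − f(i)) |ψ_⊥(i)⟩`, `⟨ψ_MPS(i)|ψ_⊥(i)⟩ = 0` — in the present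
vocabulary `ψ = √p_K · φ̂_K + χ_K` with `f(i) = p_K` (`overlapSq_truncUnit`) — and states: “the
orthogonality of the singular vectors implies that ⟨ψ_⊥(i)|O|ψ_MPS(i)⟩ = 0. This property holds for
any single site observable or, more generally, any observable localized within a region where the
MPS has been returned to its canonical form. Therefore, the approximation in Eq. (6)
[`⟨ψ|Z_tot(s)|ψ⟩ ≈ F_MPS(s)⟨ψ_MPS|Z_tot(s)|ψ_MPS⟩`] amounts to neglecting the contribution from
|ψ_⊥(i)⟩ … under the assumption that ⟨ψ_⊥|Z_tot|ψ_⊥⟩ ≈ 0” (p. 5), with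
`F_MPS(s) = Π_{i ≤ s} f_MPS(i)` (p. 4) and, for the order parameter, the modified rule
`⟨Z²_tot⟩_γ = ⟨Z²_tot⟩_MPS · F_MPS^{γ(n,χ)}` [cite: MandraEtAl2026, eq. (9)]. The primary's own
estimator is zero-truncation extrapolation: “an estimate of the associated simulation fidelity F(χ)
can be made by multiplying together the individual fidelities associated with every compression
step … we perform a linear extrapolation using the three largest bond dimensions available” to
`F → 1` [cite: HaghshenasEtAl2026, Methods §C].

## Contents (all proved; 0 named facts)

* `obsForm`, `obsForm_superpose_superpose` — bilinear expansion of `⟨Σ_A aₖwₖ|O|Σ_B bₗw'ₗ⟩`.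
* `obsForm_add_add` — `⟨φ+χ|O|φ+χ⟩ = ⟨φ|O|φ⟩ + ⟨χ|O|χ⟩ + ⟨φ|O|χ⟩ + ⟨χ|O|φ⟩`.
* `obsForm_kept_discarded_eq_zero` — if `O` has no matrix elements from kept to discarded family
  members, the cross term `⟨φ_K|O|χ_K⟩` vanishes (and symmetrically).
* `obsForm_univ_eq_kept_add_discarded` — **the exact one-step identity**:
  `⟨ψ|O|ψ⟩ = ⟨φ_K|O|φ_K⟩ + ⟨χ_K|O|χ_K⟩` under that hypothesis [cite: MandraEtAl2026, eq. (7) and the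
  sentence after it]; `obsForm_univ_eq_keptWeight_mul_add` — the same with the renormalised state:
  `⟨ψ|O|ψ⟩ = p_K · ⟨φ̂_K|O|φ̂_K⟩ + ⟨χ_K|O|χ_K⟩`, i.e. ‘exact = fidelity × (MPS value) + discarded
  term’, which is eq. (6) with its neglected term written out, and the comparison estimator
  `F·⟨O⟩_MPS + (1−F)·⟨O⟩_⊥` of [cite: MandraEtAl2026, Fig. 7] since `‖χ_K‖² = 1 − p_K`.
* Diagonal observables (`O = diagonal h`, e.g. `Z_tot`, `Z²_tot` in the computational basis):
  `obsForm_diagonal_self` (`⟨v|diag h|v⟩ = Σᵢ ‖vᵢ‖² hᵢ`), `discarded_expect_mem_Icc` (the discarded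
  term of a nonnegative `h ≤ R` lies in `[0, R·ε_K]`), and the **one-step sandwich**
  `expect_mem_Icc_keptWeight_mul` (ONE theorem, stated as a conjunction of the two inequalities):
  for `0 ≤ hᵢ ≤ R`, `p_K·⟨h⟩_{φ̂_K} ≤ ⟨h⟩_ψ ≤ p_K·⟨h⟩_{φ̂_K} + R·ε_K` — the fidelity-rescaled value
  is a LOWER bound and errs by at most `R ×` the discarded weight (this is the content of
  ‘neglecting ⟨ψ_⊥|O|ψ_⊥⟩’ for a positive bounded observable; ours to state, immediate from the
  identity — an immediate corollary stated here, not printed in the source).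
* `oneSided M` — the observable `𝟙 ⊗ M` acting on the second factor of `ι = α × β`
  (`oneSided_eq_kronecker`: it is Mathlib's `1 ⊗ₖ M`); `obsForm_oneSided_prodFamily` — for product
  family members `wₖ = Lₖ ⊗ Rₖ`, `⟨wₖ|𝟙⊗M|wₗ⟩ = ⟨Lₖ|Lₗ⟩ · ⟨Rₖ|M|Rₗ⟩`; hence
  `obsForm_oneSided_prodFamily_eq_zero` — with the LEFT factors orthonormal (Schmidt vectors) every
  `k ≠ l` matrix element vanishes: the ‘orthogonality of the singular vectors’ claim of
  [cite: MandraEtAl2026, p. 5], PROVED, so the identity above applies to every one-sided observable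
  and every kept set `K` (`obsForm_univ_eq_kept_add_discarded_oneSided`).
* Published multi-step estimators as DEFINITIONS (real-valued; no claim of accuracy):
  `fidelityProduct f s = Π_{i<s} f i` [cite: MandraEtAl2026, p. 4 (F_MPS)] = [cite: HaghshenasEtAl2026,
  Methods §C (F(χ))] with `fidelityProduct_mem_Icc` / `fidelityProduct_succ_le`;
  `rescaledEstimate O F γ = O · F^γ` [cite: MandraEtAl2026, eq. (9); γ = 1 is eq. (6)] with
  `rescaledEstimate_one_fidelity`; `lsqAtOne F O` — the least-squares line through the points
  `(Fⱼ, Oⱼ)` evaluated at `F = 1` [cite: HaghshenasEtAl2026, Methods §C (ZTE)] with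
  `lsqAtOne_of_linear`: on exactly linear data `Oⱼ = a + b Fⱼ` (non-degenerate abscissae) it
  returns `a + b` — the defining property of the extrapolation.

## References

* [MandraEtAl2026] S. Mandrà, B. Ware, N. Astrakhantsev, S. V. Isakov, B. Villalonga, T. Westerhout,
  K. Kechedzhi et al., *A Heuristic for Matrix Product State Simulation of Out-of-Equilibrium
  Dynamics of Two-Dimensional Quantum Spin Systems*, PRX Quantum (2026),
  doi:10.1103/qq2m-v44w = arXiv:2511.23438v2: eq. (5)–(7) and the paragraph after (7) (p. 4–5),
  eq. (9) (p. 6), Fig. 7 caption (p. 5). Read via `lit read arxiv:2511.23438` (pp. 1–9).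
* [HaghshenasEtAl2026] R. Haghshenas, E. Chertkov, M. Mills, W. Kadow, S.-H. Lin et al., *Digital
  quantum magnetism on a trapped-ion quantum computer*, Nature 653, 56–62 (2026),
  doi:10.1038/s41586-026-10445-3 = arXiv:2503.20870v3: Methods §C ‘Zero truncation extrapolation
  of MPS data’ (p. 8). Read via `lit read arxiv:2503.20870` (pp. 1–9, 37–38).
* [Xiang2023] for the truncation vocabulary, see `TruncatedStateFidelity.lean`.
-/

noncomputable section

open Finset Matrix
open scoped ComplexConjugate Kronecker

namespace Literature.Computability.QuantumComplexity

variable {ι κ : Type*} [Fintype ι]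

/-! ### Matrix elements of an observable -/

/-- The matrix element `⟨u|O|v⟩ = Σᵢ conj(uᵢ) (O v)ᵢ` of an observable `O` (a matrix acting on
amplitude vectors by `Matrix.mulVec`); `⟨v|O|v⟩` is the average value `⟨O⟩` in the state `v`.
[cite: NielsenChuang2010, §2.2.5 eq. (2.113)] -/
def obsForm (O : Matrix ι ι ℂ) (u v : ι → ℂ) : ℂ := braket u (O *ᵥ v)

/-- `⟨u|O|v⟩` unfolded as a double sum `Σᵢ Σⱼ conj(uᵢ) Oᵢⱼ vⱼ` (matrix representation of the
inner product and of the operator in an orthonormal basis). [cite: NielsenChuang2010, §2.1.4 eq. (2.18)] -/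
theorem obsForm_eq_sum (O : Matrix ι ι ℂ) (u v : ι → ℂ) :
    obsForm O u v = ∑ i, ∑ j, conj (u i) * (O i j * v j) := by
  unfold obsForm braket
  refine sum_congr rfl fun i _ => ?_
  rw [mulVec, dotProduct, mul_sum]

omit [Fintype ι] in
/-- `O` applied to a superposition is the superposition of the images: `O(Σ_B bₗ wₗ) = Σ_B bₗ (O wₗ)`
(linearity of the operator). [cite: NielsenChuang2010, §2.1.2 eq. (2.10)] -/
theorem mulVec_superpose [Fintype ι] (O : Matrix ι ι ℂ) (w : κ → ι → ℂ) (b : κ → ℂ) (B : Finset κ) :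
    O *ᵥ superpose w b B = superpose (fun l => O *ᵥ w l) b B := by
  ext i
  simp only [mulVec, dotProduct, superpose, mul_sum]
  rw [sum_comm]
  exact sum_congr rfl fun l _ => sum_congr rfl fun j _ => by ring

/-- Sesquilinear expansion of the form between superpositions over two (arbitrary) families:
`⟨Σ_{k∈A} aₖ wₖ | Σ_{l∈B} bₗ w'ₗ⟩ = Σ_{k∈A} Σ_{l∈B} conj(aₖ) bₗ ⟨wₖ|w'ₗ⟩` (linearity in the second
argument, conjugate symmetry). [cite: NielsenChuang2010, §2.1.4 eq. (2.13)] -/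
theorem braket_superpose_superpose' (w w' : κ → ι → ℂ) (a b : κ → ℂ) (A B : Finset κ) :
    braket (superpose w a A) (superpose w' b B) =
      ∑ k ∈ A, ∑ l ∈ B, conj (a k) * b l * braket (w k) (w' l) := by
  unfold braket superpose
  have h1 : ∀ i, conj (∑ k ∈ A, a k * w k i) * (∑ l ∈ B, b l * w' l i) =
      ∑ k ∈ A, ∑ l ∈ B, conj (a k) * b l * (conj (w k i) * w' l i) := by
    intro i
    rw [map_sum, sum_mul]
    refine sum_congr rfl fun k _ => ?_
    rw [mul_sum]
    refine sum_congr rfl fun l _ => ?_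
    rw [map_mul]
    ring
  simp_rw [h1]
  rw [sum_comm]
  refine sum_congr rfl fun k _ => ?_
  rw [sum_comm]
  refine sum_congr rfl fun l _ => ?_
  rw [mul_sum]

/-- **Sesquilinear expansion of a matrix element between superpositions.**
`⟨Σ_{k∈A} aₖ wₖ|O|Σ_{l∈B} bₗ wₗ⟩ = Σ_{k∈A} Σ_{l∈B} conj(aₖ) bₗ ⟨wₖ|O|wₗ⟩`.
[cite: NielsenChuang2010, §2.1.4 eq. (2.13) with §2.1.2 eq. (2.10)] -/
theorem obsForm_superpose_superpose (O : Matrix ι ι ℂ) (w : κ → ι → ℂ) (a b : κ → ℂ) (A B : Finset κ) :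
    obsForm O (superpose w a A) (superpose w b B) =
      ∑ k ∈ A, ∑ l ∈ B, conj (a k) * b l * obsForm O (w k) (w l) := by
  unfold obsForm
  rw [mulVec_superpose, braket_superpose_superpose']

/-- Sesquilinearity on a sum: `⟨φ+χ|O|φ+χ⟩ = ⟨φ|O|φ⟩ + ⟨χ|O|χ⟩ + ⟨φ|O|χ⟩ + ⟨χ|O|φ⟩`.
[cite: NielsenChuang2010, §2.1.4 eq. (2.13)] -/
theorem obsForm_add_add (O : Matrix ι ι ℂ) (φ χ : ι → ℂ) :
    obsForm O (φ + χ) (φ + χ) = obsForm O φ φ + obsForm O χ χ + obsForm O φ χ + obsForm O χ φ := by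
  simp only [obsForm, braket, mulVec_add, Pi.add_apply, map_add]
  rw [← sum_add_distrib, ← sum_add_distrib, ← sum_add_distrib]
  exact sum_congr rfl fun i _ => by ring

/-! ### Kept part, discarded part, and the exact one-step identity -/

omit [Fintype ι] in
/-- `ψ = φ_K + χ_K`: the state is its kept part plus its discarded part. [cite: MandraEtAl2026, eq. (7)]
(there written `U|ψ_MPS(i−1)⟩ = √f|ψ_MPS(i)⟩ + √(1−f)|ψ_⊥(i)⟩`). -/
theorem superpose_univ_eq_add [Fintype κ] [DecidableEq κ] (w : κ → ι → ℂ) (c : κ → ℂ) (K : Finset κ) :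
    superpose w c univ = superpose w c K + superpose w c (univ \ K) := by
  ext i
  rw [Pi.add_apply, ← superpose_univ_sub_superpose, add_sub_cancel]

/-- **Vanishing cross term.** If `O` has no matrix elements from kept family members to discarded
ones, `⟨wₗ|O|wₖ⟩ = 0` for `k ∈ K`, `l ∉ K`, then `⟨χ_K|O|φ_K⟩ = 0`. This is the hypothesis
[cite: MandraEtAl2026, p. 5] asserts for one-sided observables (“the orthogonality of the singular
vectors implies that ⟨ψ_⊥(i)|O|ψ_MPS(i)⟩ = 0”); it is PROVED for them below
(`obsForm_oneSided_prodFamily_eq_zero`). -/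
theorem obsForm_discarded_kept_eq_zero [Fintype κ] [DecidableEq κ] (O : Matrix ι ι ℂ) (w : κ → ι → ℂ)
    (c : κ → ℂ) (K : Finset κ) (hO : ∀ k ∈ K, ∀ l ∉ K, obsForm O (w l) (w k) = 0) :
    obsForm O (superpose w c (univ \ K)) (superpose w c K) = 0 := by
  rw [obsForm_superpose_superpose]
  refine sum_eq_zero fun l hl => sum_eq_zero fun k hk => ?_
  rw [hO k hk l (mem_sdiff.1 hl).2, mul_zero]

/-- The symmetric statement: `⟨wₖ|O|wₗ⟩ = 0` for `k ∈ K`, `l ∉ K` gives `⟨φ_K|O|χ_K⟩ = 0`.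
[cite: MandraEtAl2026, p. 5] -/
theorem obsForm_kept_discarded_eq_zero [Fintype κ] [DecidableEq κ] (O : Matrix ι ι ℂ) (w : κ → ι → ℂ)
    (c : κ → ℂ) (K : Finset κ) (hO' : ∀ k ∈ K, ∀ l ∉ K, obsForm O (w k) (w l) = 0) :
    obsForm O (superpose w c K) (superpose w c (univ \ K)) = 0 := by
  rw [obsForm_superpose_superpose]
  refine sum_eq_zero fun k hk => sum_eq_zero fun l hl => ?_
  rw [hO' k hk l (mem_sdiff.1 hl).2, mul_zero]

/-- **The exact one-step identity behind the rescaling heuristic.** If the observable does not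
connect kept and discarded family members, then
`⟨ψ|O|ψ⟩ = ⟨φ_K|O|φ_K⟩ + ⟨χ_K|O|χ_K⟩` — the expectation in the untruncated state is the
(unnormalised) kept-state term plus the discarded-state term, with no interference.
[cite: MandraEtAl2026, eq. (7) and the two sentences following it] -/
theorem obsForm_univ_eq_kept_add_discarded [Fintype κ] [DecidableEq κ] (O : Matrix ι ι ℂ) (w : κ → ι → ℂ)
    (c : κ → ℂ) (K : Finset κ) (hO : ∀ k ∈ K, ∀ l ∉ K, obsForm O (w l) (w k) = 0)
    (hO' : ∀ k ∈ K, ∀ l ∉ K, obsForm O (w k) (w l) = 0) :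
    obsForm O (superpose w c univ) (superpose w c univ) =
      obsForm O (superpose w c K) (superpose w c K) +
        obsForm O (superpose w c (univ \ K)) (superpose w c (univ \ K)) := by
  rw [superpose_univ_eq_add w c K, obsForm_add_add, obsForm_kept_discarded_eq_zero O w c K hO',
    obsForm_discarded_kept_eq_zero O w c K hO, add_zero, add_zero]

/-- The kept-state term in terms of the renormalised truncation: `⟨φ_K|O|φ_K⟩ = p_K · ⟨φ̂_K|O|φ̂_K⟩`
(when `p_K > 0`). [cite: Xiang2023, §7.3 eq. (7.30)] (normalisation) -/
theorem obsForm_kept_eq_keptWeight_mul [DecidableEq κ] (O : Matrix ι ι ℂ) (w : κ → ι → ℂ) (c : κ → ℂ)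
    {K : Finset κ} (hK : 0 < keptWeight c K) :
    obsForm O (superpose w c K) (superpose w c K) =
      (keptWeight c K : ℂ) * obsForm O (truncUnit w c K) (truncUnit w c K) := by
  have hs : 0 < Real.sqrt (keptWeight c K) := Real.sqrt_pos.2 hK
  set r : ℝ := (Real.sqrt (keptWeight c K))⁻¹ with hr
  have htr : truncUnit w c K = fun i => (r : ℂ) * superpose w c K i := rfl
  have h1 : obsForm O (truncUnit w c K) (truncUnit w c K) =
      ((r : ℂ) * (r : ℂ)) * obsForm O (superpose w c K) (superpose w c K) := by
    rw [htr, obsForm_eq_sum, obsForm_eq_sum, mul_sum]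
    refine sum_congr rfl fun i _ => ?_
    rw [mul_sum]
    refine sum_congr rfl fun j _ => ?_
    rw [map_mul, Complex.conj_ofReal]
    ring
  rw [h1, ← mul_assoc]
  have h2 : (keptWeight c K : ℂ) * ((r : ℂ) * (r : ℂ)) = 1 := by
    rw [hr, ← Complex.ofReal_mul, ← Complex.ofReal_mul, ← mul_inv, Real.mul_self_sqrt hK.le,
      mul_inv_cancel₀ hK.ne', Complex.ofReal_one]
  rw [h2, one_mul]

/-- **‘Exact = fidelity × MPS value + discarded term’.** Under the no-connection hypothesis,
`⟨ψ|O|ψ⟩ = p_K · ⟨φ̂_K|O|φ̂_K⟩ + ⟨χ_K|O|χ_K⟩`: the rescaled estimate `p_K · ⟨φ̂_K|O|φ̂_K⟩` of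
[cite: MandraEtAl2026, eq. (6)] (one step, `F = f(i) = p_K`) is exact up to the discarded state's own
(unnormalised) expectation, which eq. (6) neglects; since `‖χ_K‖² = ε_K = 1 − p_K` this is also the
comparison estimator `F⟨O⟩_MPS + (1−F)⟨O⟩_⊥` of [cite: MandraEtAl2026, Fig. 7 caption]. -/
theorem obsForm_univ_eq_keptWeight_mul_add [Fintype κ] [DecidableEq κ] (O : Matrix ι ι ℂ) (w : κ → ι → ℂ)
    (c : κ → ℂ) {K : Finset κ} (hK : 0 < keptWeight c K)
    (hO : ∀ k ∈ K, ∀ l ∉ K, obsForm O (w l) (w k) = 0) (hO' : ∀ k ∈ K, ∀ l ∉ K, obsForm O (w k) (w l) = 0) :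
    obsForm O (superpose w c univ) (superpose w c univ) =
      (keptWeight c K : ℂ) * obsForm O (truncUnit w c K) (truncUnit w c K) +
        obsForm O (superpose w c (univ \ K)) (superpose w c (univ \ K)) := by
  rw [obsForm_univ_eq_kept_add_discarded O w c K hO hO', obsForm_kept_eq_keptWeight_mul O w c hK]

/-! ### Diagonal observables: real expectations and the one-step sandwich -/

/-- For a real diagonal observable `⟨v|diag h|v⟩ = Σᵢ ‖vᵢ‖² hᵢ` — the average value as
`Σ_m m·p(m)` over computational-basis outcomes. [cite: NielsenChuang2010, §2.2.5 eqs. (2.110)–(2.113)] -/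
theorem obsForm_diagonal_self (h : ι → ℝ) (v : ι → ℂ) [DecidableEq ι] :
    obsForm (diagonal fun i => (h i : ℂ)) v v = ((∑ i, ‖v i‖ ^ 2 * h i : ℝ) : ℂ) := by
  rw [obsForm, braket, Complex.ofReal_sum]
  refine sum_congr rfl fun i _ => ?_
  rw [mulVec_diagonal, Complex.ofReal_mul, Complex.ofReal_pow, ← Complex.conj_mul' (v i)]
  ring

omit [Fintype ι] in
/-- The discarded-state term of a NONNEGATIVE diagonal observable bounded by `R` lies in
`[0, R · ε_K]`: `0 ≤ Σᵢ ‖(χ_K)ᵢ‖² hᵢ ≤ R · ε_K`, since `‖χ_K‖² = ε_K`. [cite: Xiang2023, §6.4 eq. (6.21)]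
(with [cite: NielsenChuang2010, §2.2.5 eq. (2.110)] for the average of a bounded observable) -/
theorem discarded_expect_mem_Icc [Fintype ι] [Fintype κ] [DecidableEq κ] {w : κ → ι → ℂ}
    (hw : IsOrthonormalFamily w) (c : κ → ℂ) (K : Finset κ) (h : ι → ℝ) {R : ℝ}
    (h0 : ∀ i, 0 ≤ h i) (hR : ∀ i, h i ≤ R) :
    0 ≤ ∑ i, ‖superpose w c (univ \ K) i‖ ^ 2 * h i ∧
      ∑ i, ‖superpose w c (univ \ K) i‖ ^ 2 * h i ≤ R * discardedWeight c K := by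
  refine ⟨sum_nonneg fun i _ => mul_nonneg (sq_nonneg _) (h0 i), ?_⟩
  have hε : ∑ i, ‖superpose w c (univ \ K) i‖ ^ 2 = discardedWeight c K := by
    rw [sum_norm_sq_superpose hw]; rfl
  calc ∑ i, ‖superpose w c (univ \ K) i‖ ^ 2 * h i
      ≤ ∑ i, ‖superpose w c (univ \ K) i‖ ^ 2 * R :=
        sum_le_sum fun i _ => mul_le_mul_of_nonneg_left (hR i) (sq_nonneg _)
    _ = R * discardedWeight c K := by rw [← sum_mul, hε, mul_comm]

/-- **One-step sandwich for a positive bounded diagonal observable** (e.g. `Z²_tot ∈ [0,1]`): if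
`diag h` does not connect kept and discarded family members and `0 ≤ hᵢ ≤ R`, then
`p_K · ⟨h⟩_{φ̂_K} ≤ ⟨h⟩_ψ ≤ p_K · ⟨h⟩_{φ̂_K} + R · ε_K` — the fidelity-rescaled value is a lower
bound for the exact one and errs by at most `R ×` the discarded weight — the size of the term
“neglecting the contribution from |ψ_⊥(i)⟩” drops, for a positive bounded observable.
[cite: MandraEtAl2026, eq. (7) and Fig. 7 caption (`F⟨O⟩_MPS + (1−F)⟨O⟩_⊥`)] (the bound itself is an
immediate corollary stated here, not printed there) -/
theorem expect_mem_Icc_keptWeight_mul [Fintype κ] [DecidableEq κ] [DecidableEq ι] {w : κ → ι → ℂ}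
    (hw : IsOrthonormalFamily w) (c : κ → ℂ) {K : Finset κ} (hK : 0 < keptWeight c K) (h : ι → ℝ)
    {R : ℝ} (h0 : ∀ i, 0 ≤ h i) (hR : ∀ i, h i ≤ R)
    (hO : ∀ k ∈ K, ∀ l ∉ K, obsForm (diagonal fun i => (h i : ℂ)) (w l) (w k) = 0)
    (hO' : ∀ k ∈ K, ∀ l ∉ K, obsForm (diagonal fun i => (h i : ℂ)) (w k) (w l) = 0) :
    keptWeight c K * ∑ i, ‖truncUnit w c K i‖ ^ 2 * h i ≤ ∑ i, ‖superpose w c univ i‖ ^ 2 * h i ∧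
      ∑ i, ‖superpose w c univ i‖ ^ 2 * h i ≤
        keptWeight c K * ∑ i, ‖truncUnit w c K i‖ ^ 2 * h i + R * discardedWeight c K := by
  have hid := obsForm_univ_eq_keptWeight_mul_add (diagonal fun i => (h i : ℂ)) w c hK hO hO'
  rw [obsForm_diagonal_self, obsForm_diagonal_self, obsForm_diagonal_self, ← Complex.ofReal_mul,
    ← Complex.ofReal_add] at hid
  have hreal := Complex.ofReal_injective hid
  have hd := discarded_expect_mem_Icc hw c K h h0 hR
  constructor <;> linarith [hd.1, hd.2]

/-! ### One-sided observables on a tensor-product cut: the cross term vanishes -/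

section OneSided

variable {α β : Type*} [Fintype α] [Fintype β] [DecidableEq α]

/-- The observable `𝟙 ⊗ M`: `M` acting on the second tensor factor of `ι = α × β` (the sites on
one side of the bond), identity on the first. [cite: NielsenChuang2010, §2.1.7 eq. (2.45)]; this is
the ‘single site observable or, more generally, any observable localized within a region’ on one side
of the canonical-form cut of [cite: MandraEtAl2026, p. 5]. -/
def oneSided (M : Matrix β β ℂ) : Matrix (α × β) (α × β) ℂ :=
  fun p q => if p.1 = q.1 then M p.2 q.2 else 0

omit [Fintype α] [Fintype β] in
/-- `oneSided M` is the Kronecker-product matrix `1 ⊗ₖ M` (Mathlib `Matrix.kroneckerMap`).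
[cite: NielsenChuang2010, §2.1.7 eq. (2.50)] -/
theorem oneSided_eq_kronecker (M : Matrix β β ℂ) :
    (oneSided M : Matrix (α × β) (α × β) ℂ) = (1 : Matrix α α ℂ) ⊗ₖ M := by
  ext p q
  rw [oneSided, kroneckerMap_apply, one_apply]
  split_ifs <;> simp

/-- `(𝟙 ⊗ M)` applied to a product vector `L ⊗ R` is `L ⊗ (M R)`. [cite: NielsenChuang2010, §2.1.7 eq. (2.45)] -/
theorem oneSided_mulVec_prod (M : Matrix β β ℂ) (L : α → ℂ) (R : β → ℂ) :
    oneSided M *ᵥ (fun p : α × β => L p.1 * R p.2) = fun p => L p.1 * (M *ᵥ R) p.2 := by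
  ext p
  rw [mulVec, dotProduct, Fintype.sum_prod_type, mulVec, dotProduct, mul_sum]
  rw [sum_eq_single p.1]
  · refine sum_congr rfl fun b _ => ?_
    simp only [oneSided, if_true]
    ring
  · intro a _ ha
    refine sum_eq_zero fun b _ => ?_
    simp only [oneSided, if_neg (Ne.symm ha), zero_mul]
  · intro hp; exact absurd (mem_univ _) hp

/-- **Matrix elements of a one-sided observable between product family members factorise**:
for `wₖ = Lₖ ⊗ Rₖ`, `⟨wₖ|𝟙⊗M|wₗ⟩ = ⟨Lₖ|Lₗ⟩ · ⟨Rₖ|M|Rₗ⟩` (the product inner product, eq. (2.49),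
after eq. (2.45)). [cite: NielsenChuang2010, §2.1.7 eqs. (2.45), (2.49)] -/
theorem obsForm_oneSided_prodFamily (M : Matrix β β ℂ) (L : κ → α → ℂ) (R : κ → β → ℂ) (k l : κ) :
    obsForm (oneSided M) (fun p : α × β => L k p.1 * R k p.2) (fun p => L l p.1 * R l p.2) =
      braket (L k) (L l) * obsForm M (R k) (R l) := by
  rw [obsForm, oneSided_mulVec_prod, braket, Fintype.sum_prod_type, obsForm, braket, braket,
    sum_mul_sum]
  refine sum_congr rfl fun a _ => sum_congr rfl fun b _ => ?_
  rw [map_mul]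
  ring

/-- **The ‘orthogonality of the singular vectors’ claim, proved.** If the LEFT factors `Lₖ` of a
product family `wₖ = Lₖ ⊗ Rₖ` are orthonormal (as the left Schmidt vectors across a bond are), then
a one-sided observable `𝟙 ⊗ M` has NO matrix elements between distinct family members:
`⟨wₖ|𝟙⊗M|wₗ⟩ = 0` for `k ≠ l` — whatever the right factors are. [cite: MandraEtAl2026, p. 5] -/
theorem obsForm_oneSided_prodFamily_eq_zero [DecidableEq κ] (M : Matrix β β ℂ) {L : κ → α → ℂ}
    (hL : IsOrthonormalFamily L) (R : κ → β → ℂ) {k l : κ} (hkl : k ≠ l) :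
    obsForm (oneSided M) (fun p : α × β => L k p.1 * R k p.2) (fun p => L l p.1 * R l p.2) = 0 := by
  rw [obsForm_oneSided_prodFamily, hL k l, if_neg hkl, zero_mul]

/-- Hence for a one-sided observable and a product family with orthonormal left factors the exact
one-step identity holds for EVERY kept set `K`:
`⟨ψ|𝟙⊗M|ψ⟩ = ⟨φ_K|𝟙⊗M|φ_K⟩ + ⟨χ_K|𝟙⊗M|χ_K⟩`. [cite: MandraEtAl2026, eq. (7) and p. 5] -/
theorem obsForm_univ_eq_kept_add_discarded_oneSided [Fintype κ] [DecidableEq κ] (M : Matrix β β ℂ)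
    {L : κ → α → ℂ} (hL : IsOrthonormalFamily L) (R : κ → β → ℂ) (c : κ → ℂ) (K : Finset κ) :
    let w : κ → α × β → ℂ := fun k p => L k p.1 * R k p.2
    obsForm (oneSided M) (superpose w c univ) (superpose w c univ) =
      obsForm (oneSided M) (superpose w c K) (superpose w c K) +
        obsForm (oneSided M) (superpose w c (univ \ K)) (superpose w c (univ \ K)) := by
  intro w
  refine obsForm_univ_eq_kept_add_discarded (oneSided M) w c K ?_ ?_
  · intro k hk l hl
    exact obsForm_oneSided_prodFamily_eq_zero M hL R (fun h => hl (h ▸ hk))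
  · intro k hk l hl
    exact obsForm_oneSided_prodFamily_eq_zero M hL R (fun h => hl (h ▸ hk))

end OneSided

/-! ### The published multi-step estimators (definitions; their accuracy is an empirical matter) -/

/-- The running fidelity `F(s) = Π_{i<s} f(i)` of a sequence of per-step (or per-gate) truncation
fidelities. [cite: MandraEtAl2026, p. 4 (`F_MPS(s) = Π f_MPS(i)`)] = [cite: HaghshenasEtAl2026, Methods §C
(`F(χ)` as the product of the fidelities of every compression step)] -/
def fidelityProduct (f : ℕ → ℝ) (s : ℕ) : ℝ := ∏ i ∈ range s, f i

/-- `F(s+1) = F(s) · f(s)`: the running fidelity is updated multiplicatively at each step.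
[cite: MandraEtAl2026, §III p. 4 (`F_MPS(s) = Π_{i=1}^{s} f_MPS(i)`)] -/
theorem fidelityProduct_succ (f : ℕ → ℝ) (s : ℕ) :
    fidelityProduct f (s + 1) = fidelityProduct f s * f s := by
  rw [fidelityProduct, fidelityProduct, prod_range_succ]

/-- With every factor in `[0,1]` (each `f(i)` is a fidelity), `F(s) ∈ [0,1]`.
[cite: MandraEtAl2026, §III p. 4] = [cite: HaghshenasEtAl2026, Methods §C (‘global state fidelities’)] -/
theorem fidelityProduct_mem_Icc {f : ℕ → ℝ} (hf : ∀ i, 0 ≤ f i ∧ f i ≤ 1) (s : ℕ) :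
    0 ≤ fidelityProduct f s ∧ fidelityProduct f s ≤ 1 :=
  ⟨prod_nonneg fun i _ => (hf i).1, prod_le_one (fun i _ => (hf i).1) fun i _ => (hf i).2⟩

/-- With every factor in `[0,1]`, `F` is non-increasing in the number of steps.
[cite: MandraEtAl2026, §III p. 4] -/
theorem fidelityProduct_succ_le {f : ℕ → ℝ} (hf : ∀ i, 0 ≤ f i ∧ f i ≤ 1) (s : ℕ) :
    fidelityProduct f (s + 1) ≤ fidelityProduct f s := by
  rw [fidelityProduct_succ]
  exact mul_le_of_le_one_right (fidelityProduct_mem_Icc hf s).1 (hf s).2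

/-- The fidelity-rescaled estimate `O · F^γ` of an MPS expectation value `O` with running fidelity
`F`: `γ = 1` is [cite: MandraEtAl2026, eq. (6)] (single-body `Z_tot`), general `γ = γ(n, χ)` is
[cite: MandraEtAl2026, eq. (9)] (order parameter `Z²_tot`). A DEFINITION of the published estimator;
nothing is claimed about its accuracy. -/
def rescaledEstimate (O F γ : ℝ) : ℝ := O * F ^ γ

/-- At unit fidelity the estimate is the raw value (the `χ → ∞` consistency noted after
[cite: MandraEtAl2026, eq. (9)]). -/
theorem rescaledEstimate_one_fidelity (O γ : ℝ) : rescaledEstimate O 1 γ = O := by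
  rw [rescaledEstimate, Real.one_rpow, mul_one]

/-- With `γ = 1` the estimate is `F · O`, the form of [cite: MandraEtAl2026, eq. (6)]. -/
theorem rescaledEstimate_gamma_one (O F : ℝ) : rescaledEstimate O F 1 = O * F := by
  rw [rescaledEstimate, Real.rpow_one]

/-- Zero-truncation extrapolation: the least-squares line through the points `(Fⱼ, Oⱼ)`
(fidelity, observable at bond dimension `χⱼ`) evaluated at `F = 1`:
`Ō + [Σ(Fⱼ − F̄)(Oⱼ − Ō) / Σ(Fⱼ − F̄)²] · (1 − F̄)`. [cite: HaghshenasEtAl2026, Methods §C] (“a linear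
extrapolation using the three largest bond dimensions available”, `n = 3`). A DEFINITION of the
published estimator; nothing is claimed about its accuracy. -/
def lsqAtOne {n : ℕ} (F O : Fin n → ℝ) : ℝ :=
  (∑ j, O j) / n +
    (∑ j, (F j - (∑ i, F i) / n) * (O j - (∑ i, O i) / n)) / (∑ j, (F j - (∑ i, F i) / n) ^ 2) *
      (1 - (∑ i, F i) / n)

/-- **Defining property of the extrapolation**: on exactly linear data `Oⱼ = a + b·Fⱼ` with
non-degenerate abscissae, `lsqAtOne` returns the line's value at `F = 1`, namely `a + b` — i.e. it
IS a linear extrapolation to zero truncation. [cite: HaghshenasEtAl2026, Methods §C (‘linear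
extrapolation … to the limit F → 1’)] -/
theorem lsqAtOne_of_linear {n : ℕ} (hn : 0 < n) (F : Fin n → ℝ) (a b : ℝ)
    (hS : ∑ j, (F j - (∑ i, F i) / n) ^ 2 ≠ 0) :
    lsqAtOne F (fun j => a + b * F j) = a + b := by
  have hn' : (n : ℝ) ≠ 0 := Nat.cast_ne_zero.2 hn.ne'
  set Fm : ℝ := (∑ i, F i) / n with hFm
  have hOm : (∑ j, (a + b * F j)) / n = a + b * Fm := by
    rw [sum_add_distrib, sum_const, card_univ, Fintype.card_fin, nsmul_eq_mul, ← mul_sum, hFm]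
    field_simp
  have hdev : ∀ j, (a + b * F j) - (∑ i, (a + b * F i)) / n = b * (F j - Fm) := by
    intro j; rw [hOm]; ring
  unfold lsqAtOne
  simp_rw [hdev]
  rw [hOm]
  have hSxy : ∑ j, (F j - Fm) * (b * (F j - Fm)) = b * ∑ j, (F j - Fm) ^ 2 := by
    rw [mul_sum]; exact sum_congr rfl fun j _ => by ring
  rw [hSxy, mul_div_assoc, div_self hS, mul_one]
  ring

end Literature.Computability.QuantumComplexity

end
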